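import Literature.MathematicalPhysics.QuantumFieldTheory.Balaban1983to89.Node00.BgLettersPrOfRecord
import Literature.MathematicalPhysics.QuantumFieldTheory.Balaban1983to89.Node00.BackgroundMapOfRecordChart
import Literature.MathematicalPhysics.QuantumFieldTheory.Balaban1983to89.Node00.BgSchemeChartLie
import HarnessLib

/-!
# NODE 00 — `BgSchemePrOfRecord`: THE (47)-CARRYING CHART LETTERS ON A `BgScheme`, THE FRAMED [B11] PROP. 6 SCHEME OF RECORD,
# AND THE CURED DOMAIN (small shift ∩ log-disc)

Cell `pub-ymgap` (YM-PLAN Track A), seat `pub-ymgap-node00-def-Y` (g40; custodian of the `BgScheme` instance of record), deliverable (A4) of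
★★★ director-ym №618 (3)(b) as amended by №619 (4), typed to ★★ dag-n07-w3's CURE-SPEC (T47 chart; located findings LOCATED-g28-2 «the chart of
record omits the linearizing transformation (47)» and LOCATED-g28-3 «the domain of record lacks the log-disc conjunct»).

## What is here

* §1 (generic, `namespace BgScheme`, any scheme `S` and any slot `T : GaugeField (F.P K) k (SU N) → 𝒴 → 𝒴`): the chart letters CARRYING A
  LINEARIZING TRANSFORMATION — `expoLinAt S T V A b = exp(i·ev(T_V(A + 𝔄 V))(b))`, `chartLin`, `chartCfgLin` (its value at the fixed point
  `𝒜(V) = S.sol V`), the chart relation `IsChartImageLinAt`, the tokens `ChartSULinTok`, `LieLinTokAt`, `Prop7LinTok`, and the factorisation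
  `exists_UkSel_eq_rootGauge_chartLin`; the (47)-FREE letters of `BackgroundMapOfRecord(Chart)` / `BgSchemeChartLie` are the case `T := fun _ => id`
  BY `rfl` (`expoLinAt_id`, `chartLin_id`, `chartCfgLin_id`, `lieLinTokAt_id`), so every landed theorem about `S.chart` / `S.chartCfg` stays citable.
  The structure `BgScheme` is NOT modified. [cite: Balaban1985Variational, (15) p.280, (47) p.285, (74)–(77) pp.289–290, Prop. 6 p.295, Prop. 7 p.299]
* §2 (at the record, FRAMED by a datum `𝔥 : FrameDatum (F.P K) N k U₀` of `BgAveragingPrOfRecord`): the slot of record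
  `linPrOfRecord … 𝔥 levB a hposb hQ εC = fun _ => T47 H₁^{pr} C^{sl,pr} ε_C` ([B11] (47) at the framed Sect. C pair of `BgLettersPrOfRecord` —
  the same `H`, `C^{sl}`, `ε_C` that `WprOfRecordAt` feeds to `W80`), the framed scheme `bgSchemePrOfRecord 𝔥 dom …` (= `bgSchemeOfRecord` with
  `𝒢, W, 𝔄` replaced by their framed twins `frakGprOfRecordAtBg128`, `WprOfRecordAt`, `frakAprOfRecordAtBg128`; `J`, `ev = η·evLit`, `bg = U₀`
  unchanged; the positivity / surjectivity hypotheses displayed at the FRAMED pair `(QprOfRecord 𝔥, QprimeOfRecord)`), its `rfl` projections,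
  `𝔄^{pr}(Ū^kU₀) = 0`, (45) at both framed slots (`Q_H1prOfRecordAtBg128`, `Q_H1prOfRecordAtBg` — lit `Q_H1LatticeCLM` by name), the linear
  constraint of the shift `Q^{pr}(𝔄^{pr}V) = B(V)`, and the matrices of the (47)-carrying chart of record
  `↑(𝔖.chartLin T^{pr} V A) = expOver U₀ (η • evLit (T47 … (A + 𝔄^{pr}V)))` on `SU(N)`-valued exponents.
  [cite: Balaban1985Variational, (45) p.285, (47) p.285, (103) p.293, Prop. 6 (115)–(117) p.295]
* §3 the CURED DOMAIN: the log-disc at the record's background `logDiscOfRecord k U₀ = {V | ∀ c, ‖V(c)(Ū^kU₀)(c)⋆ − 1‖ < 1}` (open, centred at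
  `Ū^kU₀`) and `curedDomPrOfRecord … t = {V | ‖𝔄^{pr}V‖ < t} ∩ logDiscOfRecord k U₀` (contains `Ū^kU₀` for `0 < t`); consumers instantiate
  `dom := curedDomPrOfRecord … t`. [cite: Balaban1985Variational, (7) p.279, (20) p.281]

## Honest limits

DEFINITIONS and bookkeeping only: no estimate of [B11] ((81), (98), (117)–(121) untouched), no token inhabited at the record, nothing continuum.
NOT here (Summits-side, by name on these letters): (48) for `T47` at the framed letters, the averaging bridge on the log-disc, the reality / trace
rows making `LieLinTokAt` hold at the record, (rng)∧(star_mem) of the K0ᴬ roads. NOT here either: `curedDomPrOfRecord ∈ 𝓝 (Ū^kU₀)` (needs the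
continuity of `B` on the log-disc) and `T47 … 0 = 0` (lit `B11Eq90V0GroupComposed.T47_zero`, under the Sect. C `Regime`; cited, not restated).
-/
noncomputable section

open scoped Matrix Matrix.Norms.L2Operator InnerProductSpace ComplexConjugate Topology

namespace Literature.MathematicalPhysics.QuantumFieldTheory.Balaban1983to89.Node00

open T4Continuum (T4Family)
open NormedSpace (exp)
open T4AdjointCovarianceUnitary (lieSU exp_mem_specialUnitaryGroup_of_mem_lieSU)
open GaugeField (gaugeAct)
open T4RootedResidualGauge (rootGauge)

/-! ## §1. The (47)-carrying chart letters on a `BgScheme` (generic; the (47)-free letters are the case `T := fun _ => id`) -/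

namespace BgScheme

variable {F : T4Family} {N : ℕ} {𝒴 𝒵 : Type} [NormedAddCommGroup 𝒴] [NormedSpace ℂ 𝒴] [NormedAddCommGroup 𝒵] [NormedSpace ℂ 𝒵] {K k : ℕ}
variable (S : BgScheme F N 𝒴 𝒵 K k) (T : GaugeField (F.P K) k (SU N) → 𝒴 → 𝒴)

/-- exponent with the linearizing transformation: `exp(i · ev(T_V(A + 𝔄 V))(b))`. [cite: Balaban1985Variational, (15) p.280, (47) p.285, (74) p.289] -/
def expoLinAt (V : GaugeField (F.P K) k (SU N)) (A : 𝒴) (b : PBond (F.P K) 0) : Matrix (Fin N) (Fin N) ℂ :=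
  exp (Complex.I • S.ev (T V (A + S.𝔄 V)) b)

/-- the (47)-carrying chart map `A ↦ (b ↦ suOfMat(exp(i·ev(T_V(A + 𝔄V))(b))) · U₀(b))`. [cite: Balaban1985Variational, (15) p.280, (47) p.285, (74)–(77) pp.289–290] -/
def chartLin (V : GaugeField (F.P K) k (SU N)) : 𝒴 → GaugeField (F.P K) 0 (SU N) :=
  fun A b => suOfMat N (S.expoLinAt T V A b) * S.bg V b

/-- the (47)-carrying chart image of the fixed point. [cite: Balaban1985Variational, Prop. 6 (116) p.295, (47) p.285, Prop. 7 p.299] -/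
def chartCfgLin (V : GaugeField (F.P K) k (SU N)) : GaugeField (F.P K) 0 (SU N) :=
  S.chartLin T V (S.sol V)

/-- unfolding. [cite: Balaban1985Variational, (15) p.280 (bookkeeping)] -/
theorem expoLinAt_apply (V : GaugeField (F.P K) k (SU N)) (A : 𝒴) (b : PBond (F.P K) 0) :
    S.expoLinAt T V A b = exp (Complex.I • S.ev (T V (A + S.𝔄 V)) b) := rfl

/-- unfolding. [cite: Balaban1985Variational, (15) p.280 (bookkeeping)] -/
theorem chartLin_apply (V : GaugeField (F.P K) k (SU N)) (A : 𝒴) (b : PBond (F.P K) 0) :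
    S.chartLin T V A b = suOfMat N (S.expoLinAt T V A b) * S.bg V b := rfl

/-- `chartLin` at the fixed point is `chartCfgLin`. [cite: Balaban1985Variational, Prop. 6 (116) p.295 (bookkeeping)] -/
theorem chartLin_sol (V : GaugeField (F.P K) k (SU N)) : S.chartLin T V (S.sol V) = S.chartCfgLin T V := rfl

/-- the (47)-free exponent is the case `T := id`. [cite: Balaban1985Variational, (15) p.280 (bookkeeping)] -/
theorem expoLinAt_id : S.expoLinAt (fun _ => id) = S.expoAt := rfl

/-- the (47)-free chart map is the case `T := id`. [cite: Balaban1985Variational, (15) p.280 (bookkeeping)] -/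
theorem chartLin_id : S.chartLin (fun _ => id) = S.chart := rfl

/-- the (47)-free chart image is the case `T := id`. [cite: Balaban1985Variational, (15) p.280 (bookkeeping)] -/
theorem chartCfgLin_id : S.chartCfgLin (fun _ => id) = S.chartCfg := rfl

/-- transparency of the retraction on `SU(N)`-valued exponents. [cite: Balaban1985Variational, (15) p.280] -/
theorem coe_chartLin_of_mem {V : GaugeField (F.P K) k (SU N)} {A : 𝒴} {b : PBond (F.P K) 0}
    (h : S.expoLinAt T V A b ∈ Matrix.specialUnitaryGroup (Fin N) ℂ) :
    ((S.chartLin T V A b : SU N) : Matrix (Fin N) (Fin N) ℂ) = S.expoLinAt T V A b * ((S.bg V b : SU N) : Matrix (Fin N) (Fin N) ℂ) := by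
  rw [chartLin_apply, suOfMat_of_mem h]
  rfl

/-- the chart relation with (47): `U(b) = exp(i·ev(T_V(A + 𝔄V))(b)) · U₀(b)`. [cite: Balaban1985Variational, (15) p.280, (47) p.285] -/
def IsChartImageLinAt (V : GaugeField (F.P K) k (SU N)) (A : 𝒴) (U : GaugeField (F.P K) 0 (SU N)) : Prop :=
  ∀ b : PBond (F.P K) 0, ((U b : SU N) : Matrix (Fin N) (Fin N) ℂ) = S.expoLinAt T V A b * ((S.bg V b : SU N) : Matrix (Fin N) (Fin N) ℂ)

/-- `chartLin` is a chart image on `SU(N)`-valued exponents. [cite: Balaban1985Variational, (15) p.280] -/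
theorem isChartImageLinAt_chartLin {V : GaugeField (F.P K) k (SU N)} {A : 𝒴}
    (h : ∀ b : PBond (F.P K) 0, S.expoLinAt T V A b ∈ Matrix.specialUnitaryGroup (Fin N) ℂ) :
    S.IsChartImageLinAt T V A (S.chartLin T V A) :=
  fun b => S.coe_chartLin_of_mem T (h b)

/-- uniqueness of the chart image. [cite: Balaban1985Variational, (15) p.280] -/
theorem IsChartImageLinAt.eq_chartLin {V : GaugeField (F.P K) k (SU N)} {A : 𝒴} {U : GaugeField (F.P K) 0 (SU N)}
    (hU : S.IsChartImageLinAt T V A U) (h : ∀ b : PBond (F.P K) 0, S.expoLinAt T V A b ∈ Matrix.specialUnitaryGroup (Fin N) ℂ) :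
    U = S.chartLin T V A := by
  funext b
  exact Subtype.ext ((hU b).trans (S.coe_chartLin_of_mem T (h b)).symm)

/-- `su(N)`-valued exponents give `SU(N)`-valued letters. [cite: Balaban1985Variational, Prop. 6 p.295, (15) p.280] -/
theorem expoLinAt_mem_of_mem_lieSU {V : GaugeField (F.P K) k (SU N)} {A : 𝒴} {b : PBond (F.P K) 0}
    (h : Complex.I • S.ev (T V (A + S.𝔄 V)) b ∈ lieSU (Fin N)) :
    S.expoLinAt T V A b ∈ Matrix.specialUnitaryGroup (Fin N) ℂ :=
  exp_mem_specialUnitaryGroup_of_mem_lieSU h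

/-- TOKEN (reality of the transformed fixed point): `exp(i·ev(T_V(𝒜V + 𝔄V))(b)) ∈ SU(N)` on the domain. [cite: Balaban1985Variational, Prop. 6 p.295, Prop. 9 p.309] -/
def ChartSULinTok : Prop :=
  ∀ V ∈ S.dom, ∀ b : PBond (F.P K) 0, S.expoLinAt T V (S.sol V) b ∈ Matrix.specialUnitaryGroup (Fin N) ℂ

/-- the exponent at the fixed point. [cite: Balaban1985Variational, Prop. 6 (116) p.295 (bookkeeping)] -/
theorem expoLinAt_sol (V : GaugeField (F.P K) k (SU N)) (b : PBond (F.P K) 0) :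
    S.expoLinAt T V (S.sol V) b = exp (Complex.I • S.ev (T V (S.sol V + S.𝔄 V)) b) := rfl

/-- TOKEN (Lie form of the reality of the transformed fixed point, at one field): `i·ev(T_V(𝒜V + 𝔄V))(b) ∈ 𝔰𝔲(N)` on every bond.
[cite: Balaban1985Variational, (15) p.280, (47) p.285, Prop. 6 p.295] -/
def LieLinTokAt (V : GaugeField (F.P K) k (SU N)) : Prop :=
  ∀ b : PBond (F.P K) 0, Complex.I • S.ev (T V (S.sol V + S.𝔄 V)) b ∈ lieSU (Fin N)

/-- Lie token ⟹ `SU(N)`-valued exponent at the fixed point. [cite: Balaban1985Variational, (15) p.280, Prop. 6 p.295] -/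
theorem expoLinAt_sol_mem_of_lieLinTokAt {V : GaugeField (F.P K) k (SU N)} (h : S.LieLinTokAt T V) (b : PBond (F.P K) 0) :
    S.expoLinAt T V (S.sol V) b ∈ Matrix.specialUnitaryGroup (Fin N) ℂ :=
  exp_mem_specialUnitaryGroup_of_mem_lieSU (h b)

/-- Lie token on the domain ⟹ `ChartSULinTok`. [cite: Balaban1985Variational, Prop. 6 p.295] -/
theorem chartSULinTok_of_lieLinTokAt (h : ∀ V ∈ S.dom, S.LieLinTokAt T V) : S.ChartSULinTok T :=
  fun V hV b => S.expoLinAt_sol_mem_of_lieLinTokAt T (h V hV) b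

/-- real transformed field ⟹ Lie token. [cite: Balaban1985Variational, (15) p.280, (47) p.285, Prop. 6 p.295] -/
theorem lieLinTokAt_of_mem_evHerm0 {V : GaugeField (F.P K) k (SU N)} (h : T V (S.sol V + S.𝔄 V) ∈ S.evHerm0) : S.LieLinTokAt T V :=
  fun b => I_smul_mem_lieSU_of_mem_herm0 ((mem_evHerm0_iff.1 h) b)

/-- a real-sector-preserving transformation of a real fixed point and a real shift gives the Lie token.
[cite: Balaban1985Variational, (47) p.285, Prop. 6 p.295, Prop. 9 p.309] -/
theorem lieLinTokAt_of_mapsTo {V : GaugeField (F.P K) k (SU N)} (hT : Set.MapsTo (T V) (S.evHerm0 : Set 𝒴) (S.evHerm0 : Set 𝒴))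
    (hsol : S.sol V ∈ S.evHerm0) (h𝔄 : S.𝔄 V ∈ S.evHerm0) : S.LieLinTokAt T V :=
  S.lieLinTokAt_of_mem_evHerm0 T (hT (add_mem hsol h𝔄))

/-- the (47)-free Lie token is the case `T := id`. [cite: Balaban1985Variational, (15) p.280 (bookkeeping)] -/
theorem lieLinTokAt_id (V : GaugeField (F.P K) k (SU N)) : S.LieLinTokAt (fun _ => id) V ↔ S.LieTokAt V := Iff.rfl

variable [NeZero N]

/-- TOKEN (Prop. 7 at the instance, (47)-carrying chart): some gauge transform of `chartCfgLin S T V` is a (0.21)-minimiser over `V`.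
[cite: Balaban1985Variational, Prop. 7 p.299, (141)–(142) p.299, (47) p.285] -/
def Prop7LinTok (ε : ℝ) : Prop :=
  ∀ V ∈ S.dom, ∃ u : GaugeTransf (F.P K) 0 (SU N),
    IsBackground (avOfRecord F N K) (bgReg F N K k ε) k V (gaugeAct u (S.chartCfgLin T V))

variable {S T} {ε : ℝ}

/-- factorisation on the domain, (47)-carrying chart. [cite: Balaban1985Variational, Thm 1 p.279, Prop. 7 p.299] -/
theorem exists_UkSel_eq_rootGauge_chartLin (hk : k ≤ (F.P K).m + (F.P K).K) (h7 : S.Prop7LinTok T ε) (hU : S.UniqTok ε)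
    {V : GaugeField (F.P K) k (SU N)} (hV : V ∈ S.dom) :
    ∃ u : GaugeTransf (F.P K) 0 (SU N), IsBackground (avOfRecord F N K) (bgReg F N K k ε) k V (gaugeAct u (S.chartCfgLin T V)) ∧
      UkSel F N K k ε V = rootGauge k (gaugeAct u (S.chartCfgLin T V)) := by
  obtain ⟨u, hu⟩ := h7 V hV
  exact ⟨u, hu, (rootGauge_eq_UkSel_of_isBackground hk (hU V hV) hu).symm⟩

end BgScheme

/-! ## §2. At the record, framed: the (47)-slot, the scheme, the chart field, (45) -/

open B9Eq311L2Pairing (WL2)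
open B11Eq103H1Complex (SiteL2K BondL2K readFun)
open B11Eq115Space (NegSize NegSup JetSup)
open B11Eq111FrakG (nabla115)
open B11Eq174Chart (Regime solA)
open B11Eq90V0GroupComposed (T47)

section Record

variable (F : T4Family) (N : ℕ) [NeZero N] (K : ℕ) (k : ℕ) (Ω : ℕ → Set (Site (F.P K) 0)) (U₀ : GaugeField (F.P K) 0 (SU N))
variable [Fact (0 < (F.L : ℝ))] [Fact (0 < (F.P K).eta k)] [Fact (0 < c0Rec F K k)] [Fact (∀ c, 0 < wBRec F K k c)]

/-- the (47)-slot of record at the framed Sect. C pair: `T_V := T47 H^{pr} C^{sl,pr} ε_C` (constant in `V`). [cite: Balaban1985Variational, (47) p.285, (45) p.285] -/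
def linPrOfRecord (𝔥 : FrameDatum (F.P K) N k U₀) (levB : PBond (F.P K) k → ℕ) (a : ℝ)
    (hposb : ∀ x, x ≠ 0 → 0 < RCLike.re ⟪x, laplaceAOfRecord F N k U₀ (QprOfRecord F N k U₀ 𝔥) (QprimeOfRecord F N k U₀) a x⟫_ℂ)
    (hQ : Function.Surjective (QprOfRecord F N k U₀ 𝔥)) (εC : ℝ) :
    GaugeField (F.P K) k (SU N) → Space115Lit F N K k Ω U₀ → Space115Lit F N K k Ω U₀ :=
  fun _ => T47 (H1prOfRecordAtBg F N K k Ω U₀ 𝔥 levB a hposb hQ) (CslprOfRecord F N K k Ω U₀ 𝔥 levB) εC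

/-- unfolding. [cite: Balaban1985Variational, (47) p.285 (bookkeeping)] -/
theorem linPrOfRecord_apply (𝔥 : FrameDatum (F.P K) N k U₀) (levB : PBond (F.P K) k → ℕ) (a : ℝ)
    (hposb : ∀ x, x ≠ 0 → 0 < RCLike.re ⟪x, laplaceAOfRecord F N k U₀ (QprOfRecord F N k U₀ 𝔥) (QprimeOfRecord F N k U₀) a x⟫_ℂ)
    (hQ : Function.Surjective (QprOfRecord F N k U₀ 𝔥)) (εC : ℝ) (V : GaugeField (F.P K) k (SU N)) (A' : Space115Lit F N K k Ω U₀) :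
    linPrOfRecord F N K k Ω U₀ 𝔥 levB a hposb hQ εC V A' =
      T47 (H1prOfRecordAtBg F N K k Ω U₀ 𝔥 levB a hposb hQ) (CslprOfRecord F N K k Ω U₀ 𝔥 levB) εC A' := rfl

/-- THE FRAMED SCHEME OF RECORD. [cite: Balaban1985Variational, Prop. 6 (115)–(117) p.295, (14) p.280, (19) p.281, (80) p.290, (103) p.293, (111) p.294; Balaban1985BackgroundPropagators, (3.113) p.418, (3.128) p.421] -/
def bgSchemePrOfRecord (𝔥 : FrameDatum (F.P K) N k U₀) (dom : Set (GaugeField (F.P K) k (SU N))) (levB : PBond (F.P K) k → ℕ)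
    (Gp : SiteL2K ℂ (F.P K).d (fun _ => (F.P K).sitesPerDir 0) (c0Rec F K k) (WRec N) →ₗ[ℂ]
      SiteL2K ℂ (F.P K).d (fun _ => (F.P K).sitesPerDir 0) (c0Rec F K k) (WRec N))
    (Δ2 : BondL2K ℂ (F.P K).d (fun _ => (F.P K).sitesPerDir 0) (c0Rec F K k) (WRec N) →ₗ[ℂ]
      BondL2K ℂ (F.P K).d (fun _ => (F.P K).sitesPerDir 0) (c0Rec F K k) (WRec N)) (a : ℝ)
    (hposπ : ∀ x, x ≠ 0 → 0 < RCLike.re ⟪x, laplaceAOfRecordAt F N k U₀ (hessOpOfRecord128 F N k U₀ Gp (QprimeOfRecord F N k U₀) Δ2)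
      (QprOfRecord F N k U₀ 𝔥) (QprimeOfRecord F N k U₀) a x⟫_ℂ)
    (hposb : ∀ x, x ≠ 0 → 0 < RCLike.re ⟪x, laplaceAOfRecord F N k U₀ (QprOfRecord F N k U₀ 𝔥) (QprimeOfRecord F N k U₀) a x⟫_ℂ)
    (hQ : Function.Surjective (QprOfRecord F N k U₀ 𝔥)) (εC B₀ C₄ a₃ j a𝔄 ε₄ : ℝ) : BgSchemeOnLit F N K k Ω U₀ where
  dom := dom
  bg := fun _ => U₀
  𝒢 := fun _ => frakGprOfRecordAtBg128 F N K k Ω U₀ 𝔥 Gp Δ2 a hposπ hQ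
  W := fun _ => WprOfRecordAt F N K k Ω U₀ 𝔥 levB a hposb hQ εC Gp
  J := fun _ => JOfRecordAtBg F N K k Ω U₀
  𝔄 := frakAprOfRecordAtBg128 F N K k Ω U₀ 𝔥 levB Gp Δ2 a hposπ hQ
  B₀ := B₀
  C₄ := C₄
  a₃ := a₃
  j := j
  a := a𝔄
  ε₄ := ε₄
  ev := ((F.P K).eta k : ℂ) • evLit F N K k Ω U₀

section Projections

variable (𝔥 : FrameDatum (F.P K) N k U₀) (dom : Set (GaugeField (F.P K) k (SU N))) (levB : PBond (F.P K) k → ℕ)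
  (Gp : SiteL2K ℂ (F.P K).d (fun _ => (F.P K).sitesPerDir 0) (c0Rec F K k) (WRec N) →ₗ[ℂ]
    SiteL2K ℂ (F.P K).d (fun _ => (F.P K).sitesPerDir 0) (c0Rec F K k) (WRec N))
  (Δ2 : BondL2K ℂ (F.P K).d (fun _ => (F.P K).sitesPerDir 0) (c0Rec F K k) (WRec N) →ₗ[ℂ]
    BondL2K ℂ (F.P K).d (fun _ => (F.P K).sitesPerDir 0) (c0Rec F K k) (WRec N)) (a : ℝ)
  (hposπ : ∀ x, x ≠ 0 → 0 < RCLike.re ⟪x, laplaceAOfRecordAt F N k U₀ (hessOpOfRecord128 F N k U₀ Gp (QprimeOfRecord F N k U₀) Δ2)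
    (QprOfRecord F N k U₀ 𝔥) (QprimeOfRecord F N k U₀) a x⟫_ℂ)
  (hposb : ∀ x, x ≠ 0 → 0 < RCLike.re ⟪x, laplaceAOfRecord F N k U₀ (QprOfRecord F N k U₀ 𝔥) (QprimeOfRecord F N k U₀) a x⟫_ℂ)
  (hQ : Function.Surjective (QprOfRecord F N k U₀ 𝔥)) (εC B₀ C₄ a₃ j a𝔄 ε₄ : ℝ) (V : GaugeField (F.P K) k (SU N))

/-- `bg V = U₀`. [cite: Balaban1985Variational, (14) p.280] -/
theorem bgSchemePrOfRecord_bg : (bgSchemePrOfRecord F N K k Ω U₀ 𝔥 dom levB Gp Δ2 a hposπ hposb hQ εC B₀ C₄ a₃ j a𝔄 ε₄).bg V = U₀ := rfl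

/-- `𝒢 V = 𝔊^{pr}(U₀)`. [cite: Balaban1985Variational, (111) p.294, (116) p.295] -/
theorem bgSchemePrOfRecord_𝒢 : (bgSchemePrOfRecord F N K k Ω U₀ 𝔥 dom levB Gp Δ2 a hposπ hposb hQ εC B₀ C₄ a₃ j a𝔄 ε₄).𝒢 V =
    frakGprOfRecordAtBg128 F N K k Ω U₀ 𝔥 Gp Δ2 a hposπ hQ := rfl

/-- `W V = W^{pr}`. [cite: Balaban1985Variational, (80) p.290, (116) p.295] -/
theorem bgSchemePrOfRecord_W : (bgSchemePrOfRecord F N K k Ω U₀ 𝔥 dom levB Gp Δ2 a hposπ hposb hQ εC B₀ C₄ a₃ j a𝔄 ε₄).W V =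
    WprOfRecordAt F N K k Ω U₀ 𝔥 levB a hposb hQ εC Gp := rfl

/-- `J V = J(U₀)`. [cite: Balaban1985Variational, (26)–(28) p.282] -/
theorem bgSchemePrOfRecord_J : (bgSchemePrOfRecord F N K k Ω U₀ 𝔥 dom levB Gp Δ2 a hposπ hposb hQ εC B₀ C₄ a₃ j a𝔄 ε₄).J V =
    JOfRecordAtBg F N K k Ω U₀ := rfl

/-- `𝔄 V = H₁^{pr}B(V)`. [cite: Balaban1985Variational, (103) p.293] -/
theorem bgSchemePrOfRecord_𝔄 : (bgSchemePrOfRecord F N K k Ω U₀ 𝔥 dom levB Gp Δ2 a hposπ hposb hQ εC B₀ C₄ a₃ j a𝔄 ε₄).𝔄 V =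
    frakAprOfRecordAtBg128 F N K k Ω U₀ 𝔥 levB Gp Δ2 a hposπ hQ V := rfl

/-- `ev = η·ev`. [cite: Balaban1985Variational, (19) p.281] -/
theorem bgSchemePrOfRecord_ev : (bgSchemePrOfRecord F N K k Ω U₀ 𝔥 dom levB Gp Δ2 a hposπ hposb hQ εC B₀ C₄ a₃ j a𝔄 ε₄).ev =
    ((F.P K).eta k : ℂ) • evLit F N K k Ω U₀ := rfl

/-- `dom` is the datum. [cite: Balaban1985Variational, (7) p.279] -/
theorem bgSchemePrOfRecord_dom : (bgSchemePrOfRecord F N K k Ω U₀ 𝔥 dom levB Gp Δ2 a hposπ hposb hQ εC B₀ C₄ a₃ j a𝔄 ε₄).dom = dom := rfl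

/-- the fixed point unfolded. [cite: Balaban1985Variational, Prop. 6 (116) p.295] -/
theorem bgSchemePrOfRecord_sol : (bgSchemePrOfRecord F N K k Ω U₀ 𝔥 dom levB Gp Δ2 a hposπ hposb hQ εC B₀ C₄ a₃ j a𝔄 ε₄).sol V =
    solA (frakGprOfRecordAtBg128 F N K k Ω U₀ 𝔥 Gp Δ2 a hposπ hQ) 0 (WprOfRecordAt F N K k Ω U₀ 𝔥 levB a hposb hQ εC Gp)
      (JOfRecordAtBg F N K k Ω U₀) ε₄ (frakAprOfRecordAtBg128 F N K k Ω U₀ 𝔥 levB Gp Δ2 a hposπ hQ V) := rfl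

/-- `𝔄^{pr} V = H₁^{pr}(B V)` (rfl). [cite: Balaban1985Variational, (103) p.293 (bookkeeping)] -/
theorem frakAprOfRecordAtBg128_eq : frakAprOfRecordAtBg128 F N K k Ω U₀ 𝔥 levB Gp Δ2 a hposπ hQ V =
    H1prOfRecordAtBg128 F N K k Ω U₀ 𝔥 levB Gp Δ2 a hposπ hQ (BOfRecord F N K k U₀ levB V) := rfl

/-- `𝔄^{pr}(Ū^k U₀) = 0`. [cite: Balaban1985Variational, (103) p.293, (20) p.281] -/
theorem frakAprOfRecordAtBg128_self :
    frakAprOfRecordAtBg128 F N K k Ω U₀ 𝔥 levB Gp Δ2 a hposπ hQ (Averaging.iter (avOfRecord F N K) k U₀) = 0 := by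
  rw [frakAprOfRecordAtBg128_eq, BOfRecord_self, map_zero]

/-- E2 at the framed scheme: `𝔄(Ū^k U₀) = 0`. [cite: Balaban1985Variational, (103) p.293, (20) p.281] -/
theorem bgSchemePrOfRecord_𝔄_self :
    (bgSchemePrOfRecord F N K k Ω U₀ 𝔥 dom levB Gp Δ2 a hposπ hposb hQ εC B₀ C₄ a₃ j a𝔄 ε₄).𝔄 (Averaging.iter (avOfRecord F N K) k U₀) = 0 :=
  frakAprOfRecordAtBg128_self F N K k Ω U₀ 𝔥 levB Gp Δ2 a hposπ hQ

/-- (45) at the framed slot (c): `Q^{pr}(H₁^{pr}B) = B`. [cite: Balaban1985Variational, (45) p.285, (103) p.293] -/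
theorem Q_H1prOfRecordAtBg128 (B : NegSize (F.L : ℝ) ((F.P K).eta k) levB 0 (Matrix (Fin N) (Fin N) ℂ)) :
    readFun (phiRec N) _ (wBRec F K k) (QprOfRecord F N k U₀ 𝔥)
        (JetSup.equiv _ _ (nabla115 ((F.P K).eta k) (unitsOfRecord F N U₀)) (H1prOfRecordAtBg128 F N K k Ω U₀ 𝔥 levB Gp Δ2 a hposπ hQ B)) =
      NegSup.equiv _ _ B :=
  B11Eq103H1Complex.Q_H1LatticeCLM (phiRec N) hposπ hQ _ _ B

/-- (45) at the framed slot (a): `Q^{pr}(H₁^{pr}B) = B`. [cite: Balaban1985Variational, (45) p.285] -/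
theorem Q_H1prOfRecordAtBg (B : NegSize (F.L : ℝ) ((F.P K).eta k) levB 0 (Matrix (Fin N) (Fin N) ℂ)) :
    readFun (phiRec N) _ (wBRec F K k) (QprOfRecord F N k U₀ 𝔥)
        (JetSup.equiv _ _ (nabla115 ((F.P K).eta k) (unitsOfRecord F N U₀)) (H1prOfRecordAtBg F N K k Ω U₀ 𝔥 levB a hposb hQ B)) =
      NegSup.equiv _ _ B :=
  B11Eq103H1Complex.Q_H1LatticeCLM (phiRec N) hposb hQ _ _ B

/-- the LINEAR constraint of the shift: `Q^{pr}(𝔄^{pr} V) = B(V)`. [cite: Balaban1985Variational, (20) p.281, (45) p.285, (103) p.293] -/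
theorem Qpr_frakAprOfRecordAtBg128 :
    readFun (phiRec N) _ (wBRec F K k) (QprOfRecord F N k U₀ 𝔥)
        (JetSup.equiv _ _ (nabla115 ((F.P K).eta k) (unitsOfRecord F N U₀)) (frakAprOfRecordAtBg128 F N K k Ω U₀ 𝔥 levB Gp Δ2 a hposπ hQ V)) =
      NegSup.equiv _ _ (BOfRecord F N K k U₀ levB V) :=
  Q_H1prOfRecordAtBg128 F N K k Ω U₀ 𝔥 levB Gp Δ2 a hposπ hQ _

/-- THE MATRICES OF THE (47)-CARRYING CHART OF RECORD: `↑(𝔖.chartLin T V A) = expOver U₀ (η • evLit (T47 H^{pr} C^{sl,pr} ε_C (A + 𝔄^{pr} V)))`.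
[cite: Balaban1985Variational, (15) p.280, (19) p.281, (47) p.285, (74) p.289] -/
theorem coeField_chartLin_eq_expOver (A : Space115Lit F N K k Ω U₀)
    (hSU : ∀ b, (bgSchemePrOfRecord F N K k Ω U₀ 𝔥 dom levB Gp Δ2 a hposπ hposb hQ εC B₀ C₄ a₃ j a𝔄 ε₄).expoLinAt
      (linPrOfRecord F N K k Ω U₀ 𝔥 levB a hposb hQ εC) V A b ∈ Matrix.specialUnitaryGroup (Fin N) ℂ) :
    coeField ((bgSchemePrOfRecord F N K k Ω U₀ 𝔥 dom levB Gp Δ2 a hposπ hposb hQ εC B₀ C₄ a₃ j a𝔄 ε₄).chartLin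
        (linPrOfRecord F N K k Ω U₀ 𝔥 levB a hposb hQ εC) V A) =
      expOver U₀ ((((F.P K).eta k : ℝ) : ℂ) • evLit F N K k Ω U₀
        (T47 (H1prOfRecordAtBg F N K k Ω U₀ 𝔥 levB a hposb hQ) (CslprOfRecord F N K k Ω U₀ 𝔥 levB) εC
          (A + frakAprOfRecordAtBg128 F N K k Ω U₀ 𝔥 levB Gp Δ2 a hposπ hQ V))) := by
  funext b
  rw [coeField_apply, BgScheme.coe_chartLin_of_mem _ _ (hSU b), expOver_apply]
  rfl

end Projections

/-! ## §3. The cured domain (LOCATED-g28-3): log-disc ∩ small shift -/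

omit [Fact (0 < (F.L : ℝ))] [Fact (0 < (F.P K).eta k)] [Fact (0 < c0Rec F K k)] [Fact (∀ c, 0 < wBRec F K k c)] in
/-- the LOG-DISC at the record's background: `‖V(c)·(Ū^kU₀)(c)⋆ − 1‖ < 1` at every level-`k` bond. [cite: Balaban1985Variational, (20) p.281, (14) p.280] -/
def logDiscOfRecord : Set (GaugeField (F.P K) k (SU N)) :=
  {V | ∀ c : PBond (F.P K) k, ‖(V c : Matrix (Fin N) (Fin N) ℂ) *
      star ((Averaging.iter (avOfRecord F N K) k U₀ c : SU N) : Matrix (Fin N) (Fin N) ℂ) - 1‖ < 1}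

omit [Fact (0 < (F.L : ℝ))] [Fact (0 < (F.P K).eta k)] [Fact (0 < c0Rec F K k)] [Fact (∀ c, 0 < wBRec F K k c)] in
/-- membership unfolded. [cite: Balaban1985Variational, (20) p.281 (bookkeeping)] -/
theorem mem_logDiscOfRecord_iff (V : GaugeField (F.P K) k (SU N)) :
    V ∈ logDiscOfRecord F N K k U₀ ↔ ∀ c : PBond (F.P K) k, ‖(V c : Matrix (Fin N) (Fin N) ℂ) *
      star ((Averaging.iter (avOfRecord F N K) k U₀ c : SU N) : Matrix (Fin N) (Fin N) ℂ) - 1‖ < 1 := Iff.rfl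

omit [Fact (0 < (F.L : ℝ))] [Fact (0 < (F.P K).eta k)] [Fact (0 < c0Rec F K k)] [Fact (∀ c, 0 < wBRec F K k c)] in
/-- the background's own average is the centre of the log-disc. [cite: Balaban1985Variational, (3) p.278, (20) p.281] -/
theorem iter_mem_logDiscOfRecord : Averaging.iter (avOfRecord F N K) k U₀ ∈ logDiscOfRecord F N K k U₀ := by
  intro c
  rw [coe_mul_star_coe_SU, sub_self, norm_zero]
  exact one_pos

omit [Fact (0 < (F.L : ℝ))] [Fact (0 < (F.P K).eta k)] [Fact (0 < c0Rec F K k)] [Fact (∀ c, 0 < wBRec F K k c)] in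
/-- the log-disc is open. [folklore] [cite: Balaban1985Variational, (20) p.281 (bookkeeping)] -/
theorem isOpen_logDiscOfRecord : IsOpen (logDiscOfRecord F N K k U₀) := by
  simp only [logDiscOfRecord, Set.setOf_forall]
  refine isOpen_iInter_of_finite fun c => ?_
  refine isOpen_lt ?_ continuous_const
  have hc : Continuous fun V : GaugeField (F.P K) k (SU N) => ((V c : SU N) : Matrix (Fin N) (Fin N) ℂ) :=
    continuous_subtype_val.comp (continuous_apply c)
  exact ((hc.mul continuous_const).sub continuous_const).norm

variable (𝔥 : FrameDatum (F.P K) N k U₀) (levB : PBond (F.P K) k → ℕ)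
  (Gp : SiteL2K ℂ (F.P K).d (fun _ => (F.P K).sitesPerDir 0) (c0Rec F K k) (WRec N) →ₗ[ℂ]
    SiteL2K ℂ (F.P K).d (fun _ => (F.P K).sitesPerDir 0) (c0Rec F K k) (WRec N))
  (Δ2 : BondL2K ℂ (F.P K).d (fun _ => (F.P K).sitesPerDir 0) (c0Rec F K k) (WRec N) →ₗ[ℂ]
    BondL2K ℂ (F.P K).d (fun _ => (F.P K).sitesPerDir 0) (c0Rec F K k) (WRec N)) (a : ℝ)
  (hposπ : ∀ x, x ≠ 0 → 0 < RCLike.re ⟪x, laplaceAOfRecordAt F N k U₀ (hessOpOfRecord128 F N k U₀ Gp (QprimeOfRecord F N k U₀) Δ2)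
    (QprOfRecord F N k U₀ 𝔥) (QprimeOfRecord F N k U₀) a x⟫_ℂ)
  (hQ : Function.Surjective (QprOfRecord F N k U₀ 𝔥))

/-- THE CURED DOMAIN OF RECORD: small shift AND log-disc. [cite: Balaban1985Variational, (7) p.279, (20) p.281, Prop. 6 p.295] -/
def curedDomPrOfRecord (t : ℝ) : Set (GaugeField (F.P K) k (SU N)) :=
  {V | ‖frakAprOfRecordAtBg128 F N K k Ω U₀ 𝔥 levB Gp Δ2 a hposπ hQ V‖ < t} ∩ logDiscOfRecord F N K k U₀

/-- membership unfolded. [cite: Balaban1985Variational, (20) p.281 (bookkeeping)] -/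
theorem mem_curedDomPrOfRecord_iff (t : ℝ) (V : GaugeField (F.P K) k (SU N)) :
    V ∈ curedDomPrOfRecord F N K k Ω U₀ 𝔥 levB Gp Δ2 a hposπ hQ t ↔
      ‖frakAprOfRecordAtBg128 F N K k Ω U₀ 𝔥 levB Gp Δ2 a hposπ hQ V‖ < t ∧ V ∈ logDiscOfRecord F N K k U₀ := Iff.rfl

/-- the cured domain sits inside the log-disc (LOCATED-g28-3's conjunct). [cite: Balaban1985Variational, (20) p.281] -/
theorem curedDomPrOfRecord_subset_logDisc (t : ℝ) :
    curedDomPrOfRecord F N K k Ω U₀ 𝔥 levB Gp Δ2 a hposπ hQ t ⊆ logDiscOfRecord F N K k U₀ :=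
  Set.inter_subset_right

/-- the cured domain sits inside the small-shift set. [cite: Balaban1985Variational, Prop. 6 p.295] -/
theorem norm_frakApr_lt_of_mem_curedDomPrOfRecord {t : ℝ} {V : GaugeField (F.P K) k (SU N)}
    (hV : V ∈ curedDomPrOfRecord F N K k Ω U₀ 𝔥 levB Gp Δ2 a hposπ hQ t) :
    ‖frakAprOfRecordAtBg128 F N K k Ω U₀ 𝔥 levB Gp Δ2 a hposπ hQ V‖ < t := hV.1

/-- the background's own average lies in the cured domain. [cite: Balaban1985Variational, (3) p.278, (20) p.281, (103) p.293] -/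
theorem iter_mem_curedDomPrOfRecord {t : ℝ} (ht : 0 < t) :
    Averaging.iter (avOfRecord F N K) k U₀ ∈ curedDomPrOfRecord F N K k Ω U₀ 𝔥 levB Gp Δ2 a hposπ hQ t := by
  refine ⟨?_, iter_mem_logDiscOfRecord F N K k U₀⟩
  show ‖_‖ < t
  rw [frakAprOfRecordAtBg128_self, norm_zero]
  exact ht

end Record

end Literature.MathematicalPhysics.QuantumFieldTheory.Balaban1983to89.Node00

end
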